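import Mathlib.Analysis.SpecialFunctions.Pow.Real
import Mathlib.Analysis.SpecialFunctions.Exp
import HarnessLib

/-!
# The Gaussian moment bound `max_r |r^c e^{−πr²t}| = (c/(2πet))^{c/2}` (CKMRV §5.1)

Cohn–Kumar–Miller–Radchenko–Viazovska, Ann. of Math. 196 (2022) = arXiv:1902.05438, §5.1, the
displayed identity used to control Schwartz seminorms of averages of Gaussians:
"`max_{r∈ℝ} |r^c e^{−πr²t}| = (c/(2πet))^{c/2}` for `c ≥ 0` and `t > 0`."

PROVED: the bound `|r|^c e^{−πr²t} ≤ (c/(2πet))^{c/2}` for all real `r` (`rpow_mul_exp_neg_le`,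
from `u ≤ e^{u−1}`), and that it is attained at `r = √(c/(2πt))` (`rpow_mul_exp_neg_eq_max`).

## References

* H. Cohn, A. Kumar, S. D. Miller, D. Radchenko, M. Viazovska, Ann. of Math. 196 (2022),
  arXiv:1902.05438, §5.1 (display after (5.4)). [CohnEtAl2019]
-/

noncomputable section

open Real

namespace Literature.Analysis.Fourier

/-- `u·e^{−u} ≤ e^{−1}` (from `u ≤ e^{u−1}`). [folklore] -/
theorem mul_exp_neg_le_exp_neg_one (u : ℝ) : u * exp (-u) ≤ exp (-1) := by
  have h := add_one_le_exp (u - 1)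
  have : u ≤ exp (u - 1) := by linarith
  calc u * exp (-u) ≤ exp (u - 1) * exp (-u) := mul_le_mul_of_nonneg_right this (exp_pos _).le
    _ = exp (-1) := by rw [← exp_add]; ring_nf

/-- **Gaussian moment bound** (CKMRV §5.1): for `c ≥ 0`, `t > 0` and every real `r`,
`|r|^c e^{−πr²t} ≤ (c/(2πet))^{c/2}`. [cite: CohnEtAl2019, §5.1] -/
theorem rpow_mul_exp_neg_le {c t : ℝ} (hc : 0 ≤ c) (ht : 0 < t) (r : ℝ) :
    |r| ^ c * exp (-π * r ^ 2 * t) ≤ (c / (2 * π * exp 1 * t)) ^ (c / 2) := by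
  rcases hc.eq_or_lt with hc0 | hcpos
  · -- `c = 0`: the bound is `e^{−πr²t} ≤ 1`
    subst hc0
    simp only [rpow_zero, one_mul, zero_div]
    rw [exp_le_one_iff]
    have : 0 ≤ π * r ^ 2 * t := by positivity
    linarith
  · -- `c > 0`: put `s = r²`, `u = 2πts/c`; then `|r|^c e^{−πr²t} = (c/(2πt))^{c/2}(ue^{−u})^{c/2}`
    have hπ := pi_pos
    set s : ℝ := r ^ 2 with hs
    have hs0 : 0 ≤ s := sq_nonneg r
    have hrs : |r| ^ c = s ^ (c / 2) := by
      rw [show s = |r| ^ (2 : ℝ) by rw [Real.rpow_two, sq_abs], ← Real.rpow_mul (abs_nonneg r)]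
      congr 1; ring
    set u : ℝ := 2 * π * t * s / c with hu
    have hu0 : 0 ≤ u := by positivity
    have hsu : s = c / (2 * π * t) * u := by rw [hu]; field_simp
    have hkey : u * exp (-u) ≤ exp (-1) := mul_exp_neg_le_exp_neg_one u
    have hA : 0 ≤ c / (2 * π * t) := by positivity
    -- rewrite both sides
    have lhs : |r| ^ c * exp (-π * r ^ 2 * t) = (c / (2 * π * t)) ^ (c / 2) * (u * exp (-u)) ^ (c / 2) := by
      rw [hrs, ← hs, hsu, Real.mul_rpow hA hu0, Real.mul_rpow hu0 (exp_pos _).le]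
      have : exp (-π * (c / (2 * π * t) * u) * t) = exp (-u) ^ (c / 2) := by
        rw [← Real.exp_mul]; congr 1; field_simp
      rw [this]; ring
    have rhs : (c / (2 * π * exp 1 * t)) ^ (c / 2) = (c / (2 * π * t)) ^ (c / 2) * (exp (-1)) ^ (c / 2) := by
      rw [← Real.mul_rpow hA (exp_pos _).le]
      congr 1
      rw [Real.exp_neg]; field_simp
    rw [lhs, rhs]
    refine mul_le_mul_of_nonneg_left ?_ (Real.rpow_nonneg hA _)
    exact Real.rpow_le_rpow (mul_nonneg hu0 (exp_pos _).le) hkey (by linarith)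

/-- The bound is attained at `r = √(c/(2πt))`: `max_r |r|^c e^{−πr²t} = (c/(2πet))^{c/2}`.
[cite: CohnEtAl2019, §5.1] -/
theorem rpow_mul_exp_neg_eq_max {c t : ℝ} (hc : 0 ≤ c) (ht : 0 < t) :
    |Real.sqrt (c / (2 * π * t))| ^ c * exp (-π * Real.sqrt (c / (2 * π * t)) ^ 2 * t) =
      (c / (2 * π * exp 1 * t)) ^ (c / 2) := by
  have hπ := pi_pos
  have hA : 0 ≤ c / (2 * π * t) := by positivity
  rw [abs_of_nonneg (Real.sqrt_nonneg _), Real.sq_sqrt hA, Real.sqrt_eq_rpow, ← Real.rpow_mul hA,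
    show (1 / 2 : ℝ) * c = c / 2 by ring]
  have : exp (-π * (c / (2 * π * t)) * t) = (exp (-1)) ^ (c / 2) := by
    rw [← Real.exp_mul]; congr 1; field_simp
  rw [this, ← Real.mul_rpow hA (exp_pos _).le]
  congr 1
  rw [Real.exp_neg]; field_simp

end Literature.Analysis.Fourier
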